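import Summits.Parity.GeneralizedHardyLittlewood.Theses.MaynardProductExact
import Literature.NumberTheory.Sieve.MaynardProductKernelCert4500
import Literature.NumberTheory.Sieve.NarrowAdmissibleTuple4500
import Literature.NumberTheory.Sieve.PolymathProductTestFunctions
import Literature.NumberTheory.Sieve.PolymathBoundedGaps
import Literature.NumberTheory.Sieve.MaynardTaoTheoremProofs
import Literature.NumberTheory.Sieve.ParityBarrierLevelProofs

/-!
# Route `MaynardProductExact`, support item `HTwoLe41664` (stmt-Parity-22651): H₂ ≤ 41 664, unconditionally

`M_4500(F_{243/2000,13/20}) > 8` (tree, `MaynardTao.eight_lt_maynardFunctional_4500`, kernel-pure certificate,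
`MaynardProductKernelCert4500.lean`) + Bombieri–Vinogradov at level `θ = 8/(M+8) < 1/2` (tree,
`BombieriVinogradovStatement_holds`) + Maynard's Proposition 4.2 (tree,
`frequently_card_primes_ge_of_maynardFunctional_holds`, `weakDHL_of_maynardFunctional_gt`) ⟹ `DHL[4500, 3]`;
with the admissible 4500-tuple of diameter 41 664 (tree, `frequently_nth_prime_add_two_le_add_41664_of_weakDHL`,
`NarrowAdmissibleTuple4500.lean`) ⟹ `p_{n+2} ≤ p_n + 41664` for infinitely many `n`.
Proof = parity-ideate-lit g27's `HTwoLe41664Assembly.lean` (refuter1 g13 K-179 re-elaborated it sorry-free as evidence).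
-/

open Filter

namespace Summit.Parity.GeneralizedHardyLittlewood.Theses.MaynardProductExact

open Literature.NumberTheory.Sieve Literature.NumberTheory.Sieve.MaynardTao

/-- `DHL[4500, 3]`: every admissible 4500-tuple has, for infinitely many `n`, at least three prime translates —
from `M_4500(F) > 8` for Polymath's product test function, Bombieri–Vinogradov at `θ = 8/(M+8) < 1/2`, and Maynard's
Proposition 4.2. -/
theorem weakDHL_4500_three : WeakDicksonHardyLittlewood 4500 3 := by
  set F := productTestFn 4500 (polymathProfile 4500 ((243 : ℝ) / 2000) ((13 : ℝ) / 20)) with hF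
  have hadm : IsMaynardAdmissible 4500 F :=
    isMaynardAdmissible_productTestFn_polymathProfile (by norm_num) (by norm_num) (by norm_num)
  set R := maynardFunctional 4500 F with hR
  have hR8 : (8 : ℝ) < R := eight_lt_maynardFunctional_4500
  set θ : ℝ := 8 / (R + 8) with hθ
  have hden : (0 : ℝ) < R + 8 := by linarith
  have hθ0 : 0 < θ := by rw [hθ]; positivity
  have hθhalf : θ < 1 / 2 := by
    rw [hθ, div_lt_iff₀ hden]; linarith
  have hlevel : PrimesHaveLevel θ := BombieriVinogradovStatement_holds θ hθhalf
  have hMθ : 2 * ((2 : ℕ) : ℝ) / θ < R := by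
    rw [hθ, div_div_eq_mul_div, div_lt_iff₀ (by positivity)]
    push_cast
    nlinarith
  exact weakDHL_of_maynardFunctional_gt frequently_card_primes_ge_of_maynardFunctional_holds hθ0
    hlevel hadm hMθ

/-- **`HTwoLe41664` holds**: `p_{n+2} ≤ p_n + 41664` for infinitely many `n` (H₂ ≤ 41 664), unconditionally. -/
theorem hTwoLe41664_holds : HTwoLe41664 :=
  frequently_nth_prime_add_two_le_add_41664_of_weakDHL weakDHL_4500_three

end Summit.Parity.GeneralizedHardyLittlewood.Theses.MaynardProductExact
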